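import Literature.MathematicalPhysics.QuantumLattice.PropMatrixWeightedMinorBound
import Literature.MathematicalPhysics.QuantumLattice.FermionicTreeExpansionDetBound
import HarnessLib

/-!
# The `n!`-free bound on truncated free-fermion expectations of chronological monomials,
# uniformly in the temperature

Assembly of `PropMatrixWeightedMinorBound.lean` (the determinant bound `δ = 2` for the Gram-weighted
minors of the chronological propagator matrix `propMatrix β h op om t`, from de Siqueira
Pedra–Salmhofer 2008) and `FermionicTreeExpansionDetBound.lean` (the Brydges–Battle–Federbush tree bound
on truncated expectations under a determinant bound): for a Hermitian one-body matrix `h`, ANY inverse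
temperature `β`, `N` creation/annihilation pairs with orbitals `op, om` and real pair times antitone in the
pair index within a window of length `β` (every Dyson term is of this form), grouped into clusters by
`c : Fin N → ι` with at most `n` pairs per cluster, and a cluster-type line bound
`‖(propMatrix β h op om t) f f'‖ ≤ M_{{c f, c f'}}`, the truncated expectation
`𝓔ᵀ(W) = ursellOf (moment c (propMatrix β h op om t)) W` obeys
`‖𝓔ᵀ(W)‖ ≤ Σ_{anchored cluster trees T on W} 2^{|F_W|} ∏_{ℓ ∈ T} (2 n² M_ℓ)`
— Benfatto–Giuliani–Mastropietro 2006, (2.77) at a single scale, with NO factor growing in `β` or in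
the norm of `h` from the determinant (the `e^{β‖h‖}` of the CAR-norm Gram bound is gone).

* `propMatrix_weightedMinor_detBound` — `propMatrix` satisfies the hypothesis `hDB` of
  `FermionicTree.norm_ursellOf_moment_le_sum_lineSets_of_detBound` with `δ = 2` (extend the row/column
  weight vectors along the injective selections and apply `norm_det_weighted_propMatrix_minor_le`);
* **`norm_ursellOf_moment_propMatrix_le_sum_lineSets`**, `norm_ursellOf_moment_propMatrix_le_pow_mul` —
  the displayed bound and its Cayley form.

Everything is PROVED; no definition and no named fact.

## References
* W. de Siqueira Pedra, M. Salmhofer, Comm. Math. Phys. 282 (2008) 797–818, Thm 1.3, Thm 2.4.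
  [cite: PedraSalmhofer2008, Thm 2.4]
* G. Benfatto, A. Giuliani, V. Mastropietro, Ann. Henri Poincaré 7 (2006) 809–898, (2.66), (2.77), (2.80).
  [cite: BenfattoGiulianiMastropietro2006, (2.77) (2.80)]
-/

noncomputable section

open Finset Matrix Literature.Probability.LatticeModels
open Literature.Probability.LatticeModels.BattleFederbush
open scoped InnerProductSpace ComplexOrder

namespace Literature.MathematicalPhysics.QuantumLattice

variable {κ : Type*} [Fintype κ] [DecidableEq κ]

/-- The real inner product of two vectors of `ℝ^m`, cast to `ℂ`, is the Hermitian pairing of their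
casts. [folklore] -/
theorem ofReal_real_inner_eq_sum_star_mul {m : ℕ} (x y : EuclideanSpace ℝ (Fin m)) :
    ((⟪x, y⟫_ℝ : ℝ) : ℂ) = ∑ r, star ((x r : ℝ) : ℂ) * ((y r : ℝ) : ℂ) := by
  rw [PiLp.inner_apply, Complex.ofReal_sum]
  refine Finset.sum_congr rfl fun r _ => ?_
  rw [Complex.star_def, Complex.conj_ofReal, ← Complex.ofReal_mul]
  congr 1
  simp [mul_comm]

/-- The cast of a unit vector of `ℝ^m` has unit Hermitian norm. [folklore] -/
theorem sqrt_sum_norm_ofReal_sq_eq_one {m : ℕ} {x : EuclideanSpace ℝ (Fin m)} (hx : ‖x‖ = 1) :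
    Real.sqrt (∑ r, ‖((x r : ℝ) : ℂ)‖ ^ 2) = 1 := by
  have h : ∑ r, ‖((x r : ℝ) : ℂ)‖ ^ 2 = ‖x‖ ^ 2 := by
    rw [EuclideanSpace.real_norm_sq_eq]
    refine Finset.sum_congr rfl fun r _ => ?_
    rw [Complex.norm_real, Real.norm_eq_abs, sq_abs]
  rw [h, hx, one_pow, Real.sqrt_one]

/-- **The chronological propagator matrix has determinant bound `2` on its Gram-weighted minors** —
the hypothesis `hDB` of `FermionicTree.norm_ursellOf_moment_le_sum_lineSets_of_detBound` for
`G = propMatrix β h op om t` (Hermitian `h`, any `β`, real pair times antitone in the pair index within a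
window of length `β`): for unit weight vectors `w : Fin r → ℝ^m`, an increasing enumeration
`e : Fin r ↪o Fin N` of pairs and strictly increasing row/column selections `ρ, γ`,
`‖det (⟨w_{ρ a}, w_{γ b}⟩ · G_{e ρ a, e γ b})‖ ≤ 2^{c'}`. [cite: PedraSalmhofer2008, Thm 2.4] -/
theorem propMatrix_weightedMinor_detBound {h : Matrix κ κ ℂ} (hh : h.IsHermitian) (β τ₀ : ℝ)
    {N : ℕ} (op om : Fin N → κ) (t : Fin N → ℝ) (ht : Antitone t)
    (hwin : ∀ a, τ₀ ≤ t a ∧ t a ≤ τ₀ + β) :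
    ∀ (m r : ℕ) (w : Fin r → EuclideanSpace ℝ (Fin m)), (∀ a, ‖w a‖ = 1) →
      ∀ (e : Fin r ↪o Fin N) (c' : ℕ) (ρ γ : Fin c' → Fin r), StrictMono ρ → StrictMono γ →
        ‖(Matrix.of fun a b : Fin c' =>
            ((⟪w (ρ a), w (γ b)⟫_ℝ : ℝ) : ℂ) *
              propMatrix β h op om (fun c => ((t c : ℝ) : ℂ)) (e (ρ a)) (e (γ b))).det‖ ≤ 2 ^ c' := by
  classical
  intro m r w hw e c' ρ γ hρ hγ
  -- extend the weights along the injective selections `e ∘ ρ`, `e ∘ γ`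
  have hinjρ : Function.Injective fun a => e (ρ a) := e.injective.comp hρ.injective
  have hinjγ : Function.Injective fun b => e (γ b) := e.injective.comp hγ.injective
  set W : Fin N → Fin m → ℂ := fun n r =>
    if hn : ∃ a, e (ρ a) = n then ((w (ρ (Classical.choose hn)) r : ℝ) : ℂ) else 0 with hW
  set W' : Fin N → Fin m → ℂ := fun n r =>
    if hn : ∃ b, e (γ b) = n then ((w (γ (Classical.choose hn)) r : ℝ) : ℂ) else 0 with hW'
  have hWρ : ∀ a r, W (e (ρ a)) r = ((w (ρ a) r : ℝ) : ℂ) := fun a r => by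
    have hn : ∃ a', e (ρ a') = e (ρ a) := ⟨a, rfl⟩
    simp only [hW, dif_pos hn]
    rw [hinjρ (Classical.choose_spec hn)]
  have hWγ : ∀ b r, W' (e (γ b)) r = ((w (γ b) r : ℝ) : ℂ) := fun b r => by
    have hn : ∃ b', e (γ b') = e (γ b) := ⟨b, rfl⟩
    simp only [hW', dif_pos hn]
    rw [hinjγ (Classical.choose_spec hn)]
  have key := norm_det_weighted_propMatrix_minor_le hh β τ₀ op om t ht hwin W W'
    (fun a => e (ρ a)) (fun b => e (γ b)) (e.monotone.comp hρ.monotone) (e.monotone.comp hγ.monotone)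
  have hmat : (Matrix.of fun a b : Fin c' =>
      (∑ r, star (W (e (ρ a)) r) * W' (e (γ b)) r) *
        propMatrix β h op om (fun c => ((t c : ℝ) : ℂ)) (e (ρ a)) (e (γ b))) =
      Matrix.of fun a b : Fin c' => ((⟪w (ρ a), w (γ b)⟫_ℝ : ℝ) : ℂ) *
        propMatrix β h op om (fun c => ((t c : ℝ) : ℂ)) (e (ρ a)) (e (γ b)) := by
    ext a b
    simp only [Matrix.of_apply, hWρ, hWγ, ofReal_real_inner_eq_sum_star_mul]
  have hnW : ∀ a, Real.sqrt (∑ r, ‖W (e (ρ a)) r‖ ^ 2) = 1 := fun a => by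
    simp only [hWρ]
    exact sqrt_sum_norm_ofReal_sq_eq_one (hw _)
  have hnW' : ∀ b, Real.sqrt (∑ r, ‖W' (e (γ b)) r‖ ^ 2) = 1 := fun b => by
    simp only [hWγ]
    exact sqrt_sum_norm_ofReal_sq_eq_one (hw _)
  rw [hmat] at key
  simp only [hnW, hnW', Finset.prod_const_one, mul_one] at key
  exact key

variable {ι : Type*} [Fintype ι] [DecidableEq ι] {v : ι}

/-- **The `n!`-free bound on the truncated expectation of chronological fermionic monomials in a free
thermal state, uniformly in the temperature** (Benfatto–Giuliani–Mastropietro 2006, (2.77) at a single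
scale, with the determinant bound (2.80) supplied by de Siqueira Pedra–Salmhofer 2008): for Hermitian
`h`, any `β`, pairs with real times antitone in the pair index within a window of length `β`, clusters
`c : Fin N → ι` with at most `n` pairs each, and a line bound `‖G f f'‖ ≤ M_{{c f, c f'}}` for
`G = propMatrix β h op om t`,
`‖𝓔ᵀ(W)‖ ≤ Σ_{T ∈ lineSets v W} 2^{|F_W|} ∏_{ℓ ∈ T} (2 n² M_ℓ)`. [cite: BenfattoGiulianiMastropietro2006, (2.77) (2.80)] -/
theorem norm_ursellOf_moment_propMatrix_le_sum_lineSets {h : Matrix κ κ ℂ} (hh : h.IsHermitian)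
    (β τ₀ : ℝ) {N : ℕ} (op om : Fin N → κ) (t : Fin N → ℝ) (ht : Antitone t)
    (hwin : ∀ a, τ₀ ≤ t a ∧ t a ≤ τ₀ + β) (c : Fin N → ι)
    {n₀ : ℕ} (hn : ∀ x : ι, (univ.filter fun f : Fin N => c f = x).card ≤ n₀)
    (M : Sym2 ι → ℝ) (hM0 : ∀ ℓ, 0 ≤ M ℓ)
    (hGM : ∀ f f', ‖propMatrix β h op om (fun a => ((t a : ℝ) : ℂ)) f f'‖ ≤ M s(c f, c f'))
    (W : Finset ι) (hv : v ∈ W) :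
    ‖ursellOf (FermionicTree.moment c (propMatrix β h op om (fun a => ((t a : ℝ) : ℂ)))) W‖ ≤
      ∑ T ∈ lineSets v W, (2 : ℝ) ^ (FermionicTree.fieldsOf c W).card *
        ∏ ℓ ∈ T, (2 * (n₀ : ℝ) ^ 2 * M ℓ) :=
  FermionicTree.norm_ursellOf_moment_le_sum_lineSets_of_detBound c _ (by norm_num)
    (propMatrix_weightedMinor_detBound hh β τ₀ op om t ht hwin) hn M hM0 hGM W hv

/-- **Cayley form** of the temperature-uniform bound: with `M*` a common bound for
`2^{|F_W|} ∏_{ℓ ∈ T} (2 n² M_ℓ)` over the anchored cluster trees on `W`, `‖𝓔ᵀ(W)‖ ≤ |W|^{|W|-2} · M*`.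
[cite: BenfattoGiulianiMastropietro2006, (2.77) (2.80)] -/
theorem norm_ursellOf_moment_propMatrix_le_pow_mul {h : Matrix κ κ ℂ} (hh : h.IsHermitian)
    (β τ₀ : ℝ) {N : ℕ} (op om : Fin N → κ) (t : Fin N → ℝ) (ht : Antitone t)
    (hwin : ∀ a, τ₀ ≤ t a ∧ t a ≤ τ₀ + β) (c : Fin N → ι)
    {n₀ : ℕ} (hn : ∀ x : ι, (univ.filter fun f : Fin N => c f = x).card ≤ n₀)
    (M : Sym2 ι → ℝ) (hM0 : ∀ ℓ, 0 ≤ M ℓ)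
    (hGM : ∀ f f', ‖propMatrix β h op om (fun a => ((t a : ℝ) : ℂ)) f f'‖ ≤ M s(c f, c f'))
    (W : Finset ι) (hv : v ∈ W) {Mstar : ℝ} (hM0' : 0 ≤ Mstar)
    (hMstar : ∀ T ∈ lineSets v W, (2 : ℝ) ^ (FermionicTree.fieldsOf c W).card *
      ∏ ℓ ∈ T, (2 * (n₀ : ℝ) ^ 2 * M ℓ) ≤ Mstar) :
    ‖ursellOf (FermionicTree.moment c (propMatrix β h op om (fun a => ((t a : ℝ) : ℂ)))) W‖ ≤
      (W.card : ℝ) ^ (W.card - 2) * Mstar :=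
  FermionicTree.norm_ursellOf_moment_le_pow_mul_of_detBound c _ (by norm_num)
    (propMatrix_weightedMinor_detBound hh β τ₀ op om t ht hwin) hn M hM0 hGM W hv hM0' hMstar

end Literature.MathematicalPhysics.QuantumLattice
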